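import Summits.Langlands.Langlands.Theses.PicardMuOrdinary
import Summits.Langlands.Langlands.Theorems.PicardMuOrdinaryIrregularClassicalityAvatarTraceLimit
import Summits.Langlands.Langlands.Theorems.PicardMuOrdinaryIrregularClassicalityHonestHeart
import Summits.Langlands.Langlands.Theorems.PicardMuOrdinaryIrregularClassicalityTraceIdentification
import Summits.Langlands.Langlands.Theorems.PicardMuOrdinaryIrregularClassicalityIrregularDescentUntwist
import Literature.NumberTheory.Automorphic.EssConjSelfDual
import Literature.NumberTheory.GaloisRepresentations.PicardCurveGaloisRepDeRham
import Literature.NumberTheory.GaloisRepresentations.PicardLambdaAdicRepChebotarev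
import Literature.NumberTheory.GaloisRepresentations.AbsIrreducibleIndexTwo
import HarnessLib

/-!
# Route `PicardMuOrdinary`, crux `IrregularClassicality` (stmt-Langlands-13758), line `slope-free-polarized-limit`:
# the UNTWISTED, ESSENTIALLY-polarized form of the line (skeleton r14) — no CM twist, no Weil character, no F2

Continuation lead prover-line-stmt-Langlands-13758-c16-0, 2026-08-17.

Skeleton r13 (lead c15) closed the typed crux modulo the wall W (`stub_polarizationDebt`), the honest heart H′
(`stub_honestHeart`) and TWO Literature debts: F1 (`picardCurve_exists_lambdaAdicRep_isDeRhamFramed`: the Picard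
`λ`-adic representation, de Rham at `λ`) and F2 (`HeckeCharacter.exists_lAdic_isDeRhamFramed`: the `3`-adic avatar of an
algebraic Hecke character is de Rham above `3`, Serre 1968 III §2.3 + Conrad 2011 App. B).  F2 (and the landed F3,
`LimitTwist`, `AlgebraicHeckeUntwist`) enter ONLY because W and H′ are typed in the EXACT conjugate-self-dual currency
`IsConjSelfDualAE c₀`: a representation of odd motivic weight (`ρ_C`, multiplier `ε⁻¹`) is exactly polarizable only after
the twist by the weight-one CM character `ψ` (ParityNote), whose `3`-adic Hodge theory is then formal debt (c15's design
remark).  The tree HAS the essential currency: `AutomorphicRepData.IsGalConjEssSelfDual σ χ`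
(`π^σ ≅ π^∨ ⊗ (χ ∘ det)`, Barnet-Lamb–Gee–Geraghty–Taylor §2.1 "polarized", Fakhruddin–Pilloni §9.1).  In that currency
the geometric input of the heart is the UNTWISTED `ρ_C` — F1 alone.

This file is the kernel-checked glue of the reshaped line (r14; stubs W♮ `stub_essPolarizationDebt`, F1
`stub_picardLambdaAdicRepDeRham`, H♮ `stub_honestHeartEss`):

* `exists_avatarLimit_ess` — the `3`-adic trace limit of the avatars of an ESSENTIALLY `c₀`-polarized regular cuspidal
  tower converging in `ι`-adic Satake sums to the UNTWISTED Picard traces `e(a_𝔭(f))` (c14's `stub_traceLimit`, p145892,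
  fed exactly as in `exists_avatarLimit`; the polarization clause is idle here, as it was there).
* `isResiduallyAbsIrreducible_of_frobTraces_untwisted` — c15's residual absolute irreducibility R at `ϖ ≡ 1`
  (`a_𝔭 · 1 = a_𝔭`; the residual traces `#Fix − 1` only see `a_𝔭 mod (1 − ω)`).
* `geometricDeRhamInput_untwisted` — G♮ from F1 ALONE: `ρ_C` through `j = ι⁻¹ ∘ e`, unramified with traces
  `ι⁻¹ e(a_𝔭)` off `S₀ ∪ {bad places}` (`picard_setOf_badPlace_finite`), absolutely irreducible, de Rham at `v ∣ 3`.
* `irregularClassicalityEssPolarized_of_essHeart` — **C3♮ from F1 and H♮**: an essentially-polarized avatar tower for the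
  untwisted traces ⇒ `C_f` automorphic over `K` (avatar limit `ρ`; R; G♮; I = `stub_traceIdentification` p156424;
  H♮; `tr ρ(Frob_𝔭⁻¹) = ι⁻¹(Σα)` in the normalisation `m = 1`, `trace_inv_eq_of_hasFrobCharpolyAt_one` — no untwist).
* `irregularClassicality_of_essWall_of_essHeart` — **the typed crux from W♮, F1, H♮**, W♮ taking the crux hypothesis
  VERBATIM (no `LimitTwist`).

H♮ ("a `3`-adically pro-automorphic ESSENTIALLY-`c₀`-polarized, de Rham at `λ`, residually absolutely irreducible
`ρ : Γ_{ℚ(ω)} → GL₃(ℚ̄₃)` is automorphic") is the `GU(2,1)` (similitude / Picard-modular-surface) currency of the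
honest heart — implied by Fontaine–Mazur + reciprocity exactly as H′ is, and the currency in which `ρ_C` itself
(multiplier `ε⁻¹`) is a polarized pair; W♮ is the same `3`-adic descent wall as W, in the untwisted currency.  Nothing
here closes the item.

References: T. Barnet-Lamb, T. Gee, D. Geraghty, R. Taylor, Ann. of Math. 179 (2014) §2.1; N. Fakhruddin, V. Pilloni,
arXiv:1910.03790 §9.1; R. Taylor, Duke Math. J. 63 (1991) §1; H. Darmon, F. Diamond, R. Taylor (1995) §2.1;
G. Faltings (1989); C. Upton, J. Algebra 322 (2009) Thm. 2.1.
-/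

open Literature.NumberTheory.GaloisRepresentations Literature.NumberTheory.Automorphic
open Literature.NumberTheory
open Literature.RepresentationTheory.Semisimple
open scoped Pointwise NumberField
open IsDedekindDomain NumberField Polynomial Filter Topology Field

-- `Summit.Langlands.Langlands.…` (summit = sub-problem name, D-0017 layout) trips `dupNamespace` on every decl.
set_option linter.dupNamespace false
set_option autoImplicit false

namespace Summit.Langlands.Langlands.Theorems.IrregularClassicality.SlopeFreePolarizedLimit

noncomputable section

/-! ### The avatar limit of an essentially-polarized tower, untwisted traces -/

/-- **The trace limit of the avatars (essential currency, untwisted traces).**  From an essentially `c₀`-polarized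
avatar tower whose `ι`-adic Satake sums converge to `e(a_𝔭(f))` off `S₀`: a continuous semisimple
`ρ : Γ_K → GL₃(ℚ̄₃)` killing every inertia group at places `v ∉ S₀` and with geometric-Frobenius traces `ι⁻¹ e(a_𝔭)`
there (Taylor's pseudo-representation limit, the landed `stub_traceLimit`; the regularity and polarization clauses are
not used). -/
theorem exists_avatarLimit_ess (f : ℤ[X]) (hcpt : isCompact_glFiniteIntegralLevel 3 (CyclotomicField 3 ℚ))
    (ι : PadicAlgCl 3 ≃+* ℂ) (e : (CyclotomicField 3 ℚ) →+* ℂ) (S₀ : Finset (HeightOneSpectrum (𝓞 (CyclotomicField 3 ℚ))))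
    (c₀ : (CyclotomicField 3 ℚ) ≃ₐ[ℚ] (CyclotomicField 3 ℚ))
    (htower : ∀ k : ℕ, ∃ (P : CuspidalAutomorphicRepData 3 (CyclotomicField 3 ℚ) hcpt) (r : FramedGaloisRep (CyclotomicField 3 ℚ) (PadicAlgCl 3) 3)
      (χ : Literature.NumberTheory.GaloisRepresentations.HeckeCharacter (CyclotomicField 3 ℚ)),
      P.1.IsRegularAlgebraic ∧ P.1.IsGalConjEssSelfDual c₀ χ ∧
      ∀ 𝔭 ∉ S₀, P.1.IsUnramifiedAt 𝔭 ∧ IsGaloisCompatibleAt P.1 ι r 𝔭 ∧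
        ∃ (α : Multiset ℂ) (t : integralClosure ℤ ℂ), P.1.HasSatakeParamAt 𝔭 α ∧
          (t : ℂ) = (𝔭.residueCard : ℂ) * α.sum - e (picardTrace f 𝔭) ∧
          ‖ι.symm (t : ℂ)‖ ≤ ((3 : ℝ)⁻¹) ^ k) :
    ∃ ρ : FramedGaloisRep (CyclotomicField 3 ℚ) (PadicAlgCl 3) 3,
      (FramedRep.toRepresentation ρ).IsSemisimpleRepresentation ∧
      (∀ 𝔭 ∉ S₀, ρ.IsUnramifiedAt 𝔭 ∧
        ∀ 𝔓 ∈ 𝔭.primesAbove, ∀ τ : absoluteGaloisGroup (CyclotomicField 3 ℚ), IsArithFrobAt (𝓞 (CyclotomicField 3 ℚ)) τ 𝔓 →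
          FramedRep.trace ρ τ⁻¹ = ι.symm (e (picardTrace f 𝔭))) := by
  classical
  choose P r _χ _hreg _hcsd hPr using htower
  -- the dense set of geometric Frobenii off `S₀`, the inertia elements off `S₀`
  set D : Set (absoluteGaloisGroup (CyclotomicField 3 ℚ)) :=
    {g | ∃ v ∉ (S₀ : Set (HeightOneSpectrum (𝓞 (CyclotomicField 3 ℚ)))), ∃ 𝔓 ∈ v.primesAbove, IsArithFrobAt (𝓞 (CyclotomicField 3 ℚ)) g⁻¹ 𝔓}
    with hDdef
  have hD : Dense D := by
    have h := absoluteGaloisGroup.frobenius_dense chebotarev_artinRep_holds (CyclotomicField 3 ℚ)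
      (S₀ : Set (HeightOneSpectrum (𝓞 (CyclotomicField 3 ℚ)))) S₀.finite_toSet
    have hpre : D = (fun g : absoluteGaloisGroup (CyclotomicField 3 ℚ) => g⁻¹) ⁻¹'
        {σ | ∃ v ∉ (S₀ : Set (HeightOneSpectrum (𝓞 (CyclotomicField 3 ℚ)))), ∃ 𝔓 ∈ v.primesAbove, IsArithFrobAt (𝓞 (CyclotomicField 3 ℚ)) σ 𝔓} := rfl
    rw [hpre]
    exact h.preimage (Homeomorph.inv (absoluteGaloisGroup (CyclotomicField 3 ℚ))).isOpenMap
  set I : Set (absoluteGaloisGroup (CyclotomicField 3 ℚ)) :=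
    {τ | ∃ v ∉ (S₀ : Set (HeightOneSpectrum (𝓞 (CyclotomicField 3 ℚ)))), ∃ 𝔓 ∈ v.primesAbove, τ ∈ 𝔓.inertia (absoluteGaloisGroup (CyclotomicField 3 ℚ))}
    with hIdef
  -- the target values on `D`
  have hDex : ∀ g ∈ D, ∃ v : HeightOneSpectrum (𝓞 (CyclotomicField 3 ℚ)), v ∉ S₀ ∧ ∃ 𝔓 ∈ v.primesAbove, IsArithFrobAt (𝓞 (CyclotomicField 3 ℚ)) g⁻¹ 𝔓 := by
    rintro g ⟨v, hv, 𝔓, h𝔓, hg⟩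
    exact ⟨v, fun h => hv h, 𝔓, h𝔓, hg⟩
  let vOf : ∀ g ∈ D, HeightOneSpectrum (𝓞 (CyclotomicField 3 ℚ)) := fun g hg => (hDex g hg).choose
  have hvOf : ∀ g (hg : g ∈ D), vOf g hg ∉ S₀ ∧ ∃ 𝔓 ∈ (vOf g hg).primesAbove, IsArithFrobAt (𝓞 (CyclotomicField 3 ℚ)) g⁻¹ 𝔓 :=
    fun g hg => (hDex g hg).choose_spec
  let t : absoluteGaloisGroup (CyclotomicField 3 ℚ) → PadicAlgCl 3 := fun g =>
    if hg : g ∈ D then ι.symm (e (picardTrace f (vOf g hg))) else 0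
  obtain ⟨E, hEfin, hE⟩ := exists_intermediateField_mem ι e
  haveI := hEfin
  have htE : ∀ g ∈ D, t g ∈ E := fun g hg => by
    simp only [t, dif_pos hg]
    exact hE _
  -- the two hypotheses of S1
  have hI : ∀ m : ℕ, ∀ τ ∈ I, r m τ = 1 := by
    rintro m τ ⟨v, hv, 𝔓, h𝔓, hτ⟩
    obtain ⟨-, hcomp, α, tt, hα, -, -⟩ := hPr m v (fun h => hv h)
    exact apply_eq_one_of_compatible hcomp hα h𝔓 hτ
  have hpow : ∀ m : ℕ, ((3 : ℝ)⁻¹) ^ m = ((3 : ℕ) : ℝ) ^ (-(m : ℤ)) := fun m => by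
    rw [zpow_neg, zpow_natCast, inv_pow, Nat.cast_ofNat]
  have happ : ∀ m : ℕ, ∀ g ∈ D, ‖FramedRep.trace (r m) g - t g‖ ≤ ((3 : ℕ) : ℝ) ^ (-(m : ℤ)) := by
    intro m g hg
    obtain ⟨hv, 𝔓, h𝔓, hσ⟩ := hvOf g hg
    obtain ⟨-, hcomp, α, tt, hα, htt, hnorm⟩ := hPr m (vOf g hg) hv
    simp only [t, dif_pos hg]
    rw [← hpow]
    have h := norm_trace_inv_sub_le_of_compatible hcomp hα htt hnorm h𝔓 hσ
    rwa [inv_inv] at h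
  obtain ⟨ρ, hss, hρI, happrox, -⟩ :=
    stub_traceLimit (absoluteGaloisGroup (CyclotomicField 3 ℚ)) 3 3 E D hD t htE I r hI happ
  refine ⟨ρ, hss, fun 𝔭 h𝔭 => ⟨fun 𝔓 h𝔓 τ hτ => hρI τ ⟨𝔭, fun h => h𝔭 h, 𝔓, h𝔓, hτ⟩, fun 𝔓 h𝔓 τ hτ => ?_⟩⟩
  -- the trace at a geometric Frobenius: both `tr r_m(τ⁻¹)` bounds tend to `0`
  have hb : ∀ m : ℕ, ‖FramedRep.trace ρ τ⁻¹ - ι.symm (e (picardTrace f 𝔭))‖ ≤ ((3 : ℕ) : ℝ) ^ (-(m : ℤ)) := by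
    intro m
    obtain ⟨-, hcomp, α, tt, hα, htt, hnorm⟩ := hPr m 𝔭 h𝔭
    have h1 := norm_trace_inv_sub_le_of_compatible hcomp hα htt hnorm h𝔓 hτ
    rw [hpow m] at h1
    have h2 := happrox m τ⁻¹
    have e1 : FramedRep.trace ρ τ⁻¹ - ι.symm (e (picardTrace f 𝔭)) =
        (FramedRep.trace (r m) τ⁻¹ - ι.symm (e (picardTrace f 𝔭))) -
          (FramedRep.trace (r m) τ⁻¹ - FramedRep.trace ρ τ⁻¹) := by ring
    rw [e1]
    have nsub : ∀ a b : PadicAlgCl 3, ‖a - b‖ ≤ max ‖a‖ ‖b‖ := fun a b => by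
      simpa [sub_eq_add_neg, norm_neg] using IsUltrametricDist.norm_add_le_max a (-b)
    exact (nsub _ _).trans (max_le h1 h2)
  have h0 : ‖FramedRep.trace ρ τ⁻¹ - ι.symm (e (picardTrace f 𝔭))‖ ≤ 0 :=
    ge_of_tendsto' (LadicLimit.tendsto_zpow_neg_natCast (ℓ := 3)) hb
  rw [← sub_eq_zero, ← norm_le_zero_iff]
  exact h0

/-! ### R at `ϖ ≡ 1`: residual absolute irreducibility from the UNTWISTED Picard traces -/

/-- **Residual absolute irreducibility from the untwisted traces** (c15's `isResiduallyAbsIrreducible_of_frobTraces`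
at the constant primary datum `ϖ ≡ 1`: `a_𝔭 · 1 = a_𝔭`, and `1 − 1 = 0 ∈ (3)`).  For generic `f` (`12 ∣ #Gal(f/ℚ)`), a
continuous `ρ : Γ_K → GL₃(ℚ̄₃)` with geometric-Frobenius traces `ι⁻¹ e(a_𝔭(f))` off a finite set is residually
absolutely irreducible (residual traces `#Fix − 1` = augmentation character; Darmon–Diamond–Taylor §2.1). -/
theorem isResiduallyAbsIrreducible_of_frobTraces_untwisted (f : ℤ[X]) (hdeg : f.natDegree = 4)
    (hsep : (f.map (Int.castRingHom ℚ)).Separable) (hgal : 12 ∣ Nat.card (f.map (Int.castRingHom ℚ)).Gal)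
    (ι : PadicAlgCl 3 ≃+* ℂ) (e : (CyclotomicField 3 ℚ) →+* ℂ) (S₀ : Finset (HeightOneSpectrum (𝓞 (CyclotomicField 3 ℚ))))
    (ρ : FramedGaloisRep (CyclotomicField 3 ℚ) (PadicAlgCl 3) 3)
    (htr : ∀ 𝔭 ∉ S₀, ∀ 𝔓 ∈ 𝔭.primesAbove, ∀ τ : absoluteGaloisGroup (CyclotomicField 3 ℚ), IsArithFrobAt (𝓞 (CyclotomicField 3 ℚ)) τ 𝔓 →
      FramedRep.trace ρ τ⁻¹ = ι.symm (e (picardTrace f 𝔭))) :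
    ρ.IsResiduallyAbsIrreducible := by
  refine isResiduallyAbsIrreducible_of_frobTraces f hdeg hsep hgal ι e S₀ (fun _ => 1) ρ (fun 𝔭 _ => ?_)
    (fun 𝔭 h𝔭 𝔓 h𝔓 τ hτ => ?_)
  · simp only [sub_self, Submodule.zero_mem]
  · rw [mul_one]
    exact htr 𝔭 h𝔭 𝔓 h𝔓 τ hτ

/-! ### G♮: the geometric de Rham input from F1 alone -/

/-- **G♮ — the de Rham Picard representation, untwisted** (from F1 = `picardCurve_exists_lambdaAdicRep_isDeRhamFramed`
ALONE; no CM twist, no Weil character): for generic `f`, `ι`, `e` and any finite `S₀`, the Picard representation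
`ρ_C` through `j = ι⁻¹ ∘ e` is unramified with geometric-Frobenius traces `ι⁻¹ e(a_𝔭(f))` off `S₁ := S₀ ∪ {bad places}`
(`picard_setOf_badPlace_finite`), absolutely irreducible, and de Rham at every `v ∣ 3` for Fontaine's pinned datum. -/
theorem geometricDeRhamInput_untwisted
    (hF1 : Literature.NumberTheory.GaloisRepresentations.picardCurve_exists_lambdaAdicRep_isDeRhamFramed)
    (f : ℤ[X]) (hdeg : f.natDegree = 4) (hsep : (f.map (Int.castRingHom ℚ)).Separable)
    (hgal : 12 ∣ Nat.card (f.map (Int.castRingHom ℚ)).Gal)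
    (ι : PadicAlgCl 3 ≃+* ℂ) (e : (CyclotomicField 3 ℚ) →+* ℂ) (S₀ : Finset (HeightOneSpectrum (𝓞 (CyclotomicField 3 ℚ)))) :
    ∃ (ρ : FramedGaloisRep (CyclotomicField 3 ℚ) (PadicAlgCl 3) 3) (S₁ : Finset (HeightOneSpectrum (𝓞 (CyclotomicField 3 ℚ)))),
      S₀ ⊆ S₁ ∧
      (∀ 𝔭 ∉ S₁, ρ.IsUnramifiedAt 𝔭 ∧
        ∀ 𝔓 ∈ 𝔭.primesAbove, ∀ τ : absoluteGaloisGroup (CyclotomicField 3 ℚ), IsArithFrobAt (𝓞 (CyclotomicField 3 ℚ)) τ 𝔓 →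
          FramedRep.trace ρ τ⁻¹ = ι.symm (e (picardTrace f 𝔭))) ∧
      FramedRep.IsAbsolutelyIrreducible ρ ∧
      (∀ (v : HeightOneSpectrum (𝓞 (CyclotomicField 3 ℚ))) (hv : ((3 : ℕ) : 𝓞 (CyclotomicField 3 ℚ)) ∈ v.asIdeal),
        (PAdicHodge.fontainePstAdicCompletion v 3 hv).IsDeRhamFramed (ρ.toLocal v)) := by
  classical
  obtain ⟨ρC, hρC, hirr, hρCdR⟩ := hF1 f hdeg hsep (ι.symm.toRingHom.comp e)
  set Bad : Set (HeightOneSpectrum (𝓞 (CyclotomicField 3 ℚ))) :=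
    {v | ¬ ((3 : 𝓞 (CyclotomicField 3 ℚ)) ∉ v.asIdeal ∧
      (f.map ((Ideal.Quotient.mk v.asIdeal).comp (algebraMap ℤ (𝓞 (CyclotomicField 3 ℚ))))).natDegree = 4 ∧
      (f.map ((Ideal.Quotient.mk v.asIdeal).comp (algebraMap ℤ (𝓞 (CyclotomicField 3 ℚ))))).Separable)}
    with hBad
  have hBadfin : Bad.Finite := picard_setOf_badPlace_finite f hdeg hsep
  refine ⟨ρC, S₀ ∪ hBadfin.toFinset, Finset.subset_union_left, fun 𝔭 h𝔭 => ?_, hirr hgal, hρCdR⟩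
  rw [Finset.mem_union, not_or, Set.Finite.mem_toFinset] at h𝔭
  have hgood : (3 : 𝓞 (CyclotomicField 3 ℚ)) ∉ 𝔭.asIdeal ∧
      (f.map ((Ideal.Quotient.mk 𝔭.asIdeal).comp (algebraMap ℤ (𝓞 (CyclotomicField 3 ℚ))))).natDegree = 4 ∧
      (f.map ((Ideal.Quotient.mk 𝔭.asIdeal).comp (algebraMap ℤ (𝓞 (CyclotomicField 3 ℚ))))).Separable := by
    by_contra h
    exact h𝔭.2 h
  obtain ⟨hunr, hfrob⟩ := hρC 𝔭 hgood.1 hgood.2.1 hgood.2.2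
  refine ⟨hunr, fun 𝔓 h𝔓 τ hτ => ?_⟩
  rw [hfrob 𝔓 h𝔓 τ hτ]
  rfl

/-! ### C3♮ from F1 and H♮; the typed crux from W♮, F1 and H♮ -/

/-- **C3♮ from F1 and the essential heart H♮.**  For generic `f`: an essentially `c₀`-polarized regular algebraic
cuspidal tower on `GL₃(𝔸_K)` with Galois avatars, `S ⊇ {v ∣ 3}`, whose `ι`-adic Satake sums converge to the
UNTWISTED Picard traces `e(a_𝔭(f))` off `S` ⇒ `C_f` is automorphic over `K = ℚ(ω)` (verbatim the crux's conclusion).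
Proof: avatar limit `ρ` (`exists_avatarLimit_ess`), residually absolutely irreducible
(`isResiduallyAbsIrreducible_of_frobTraces_untwisted`) hence absolutely irreducible (Darmon–Diamond–Taylor §2.1); the
geometric `ρ_C` of F1 has the same traces off `S₁ ⊇ S` and is de Rham (`geometricDeRhamInput_untwisted`), so `ρ` is de
Rham (I = `stub_traceIdentification`); H♮ gives a cuspidal L-algebraic `π'` with `charpoly ρ(Frob_𝔭) =
arithFrobPolyOfSatake ι N𝔭 1 α` a.e., whence `Σα = e(a_𝔭)` (`trace_inv_eq_of_hasFrobCharpolyAt_one`). -/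
theorem irregularClassicalityEssPolarized_of_essHeart
    (hF1 : Literature.NumberTheory.GaloisRepresentations.picardCurve_exists_lambdaAdicRep_isDeRhamFramed)
    (hH : ∀ (hcpt : isCompact_glFiniteIntegralLevel 3 (CyclotomicField 3 ℚ)) (ι : PadicAlgCl 3 ≃+* ℂ)
        (c₀ : (CyclotomicField 3 ℚ) ≃ₐ[ℚ] (CyclotomicField 3 ℚ)) (S : Finset (HeightOneSpectrum (𝓞 (CyclotomicField 3 ℚ))))
        (ρ : FramedGaloisRep (CyclotomicField 3 ℚ) (PadicAlgCl 3) 3),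
        c₀ ≠ 1 →
        (∀ v : HeightOneSpectrum (𝓞 (CyclotomicField 3 ℚ)), ((3 : ℕ) : 𝓞 (CyclotomicField 3 ℚ)) ∈ v.asIdeal → v ∈ S) →
        ρ.IsResiduallyAbsIrreducible →
        (∀ (v : HeightOneSpectrum (𝓞 (CyclotomicField 3 ℚ))) (hv : ((3 : ℕ) : 𝓞 (CyclotomicField 3 ℚ)) ∈ v.asIdeal),
          (PAdicHodge.fontainePstAdicCompletion v 3 hv).IsDeRhamFramed (ρ.toLocal v)) →
        (∀ 𝔭 ∉ S, ρ.IsUnramifiedAt 𝔭) →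
        (∀ k : ℕ, ∃ (P : CuspidalAutomorphicRepData 3 (CyclotomicField 3 ℚ) hcpt) (r : FramedGaloisRep (CyclotomicField 3 ℚ) (PadicAlgCl 3) 3)
          (χ : Literature.NumberTheory.GaloisRepresentations.HeckeCharacter (CyclotomicField 3 ℚ)),
          P.1.IsRegularAlgebraic ∧ P.1.IsGalConjEssSelfDual c₀ χ ∧
          ∀ 𝔭 ∉ S, P.1.IsUnramifiedAt 𝔭 ∧ IsGaloisCompatibleAt P.1 ι r 𝔭 ∧
            ∃ α : Multiset ℂ, P.1.HasSatakeParamAt 𝔭 α ∧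
              ∀ 𝔓 ∈ 𝔭.primesAbove, ∀ τ : absoluteGaloisGroup (CyclotomicField 3 ℚ), IsArithFrobAt (𝓞 (CyclotomicField 3 ℚ)) τ 𝔓 →
                ‖ι.symm ((𝔭.residueCard : ℂ) * α.sum) - FramedRep.trace ρ τ⁻¹‖ ≤ ((3 : ℝ)⁻¹) ^ k) →
        ∃ (π' : CuspidalAutomorphicRepData 3 (CyclotomicField 3 ℚ) hcpt) (S' : Finset (HeightOneSpectrum (𝓞 (CyclotomicField 3 ℚ)))),
          π'.1.IsLAlgebraic ∧
          ∀ 𝔭 ∉ S', ∃ α : Multiset ℂ, π'.1.HasSatakeParamAt 𝔭 α ∧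
            ρ.IsUnramifiedAt 𝔭 ∧ ρ.HasFrobCharpolyAt 𝔭 (arithFrobPolyOfSatake ι 𝔭.residueCard 1 α)) :
    ∀ (f : Polynomial ℤ) (hcpt : Literature.NumberTheory.Automorphic.isCompact_glFiniteIntegralLevel 3 (CyclotomicField 3 ℚ)), f.natDegree = 4 → (f.map (Int.castRingHom ℚ)).Separable → 12 ∣ Nat.card (f.map (Int.castRingHom ℚ)).Gal → (∃ (e : (CyclotomicField 3 ℚ) →+* ℂ) (ι : PadicAlgCl 3 ≃+* ℂ) (S : Finset (IsDedekindDomain.HeightOneSpectrum (NumberField.RingOfIntegers (CyclotomicField 3 ℚ)))) (c₀ : (CyclotomicField 3 ℚ) ≃ₐ[ℚ] (CyclotomicField 3 ℚ)), c₀ ≠ 1 ∧ (∀ v : IsDedekindDomain.HeightOneSpectrum (NumberField.RingOfIntegers (CyclotomicField 3 ℚ)), ((3 : ℕ) : NumberField.RingOfIntegers (CyclotomicField 3 ℚ)) ∈ v.asIdeal → v ∈ S) ∧ ∀ k : ℕ, ∃ (P : Literature.NumberTheory.Automorphic.CuspidalAutomorphicRepData 3 (CyclotomicField 3 ℚ)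 hcpt) (r : Literature.NumberTheory.GaloisRepresentations.FramedGaloisRep (CyclotomicField 3 ℚ) (PadicAlgCl 3) 3) (χ : Literature.NumberTheory.GaloisRepresentations.HeckeCharacter (CyclotomicField 3 ℚ)), P.1.IsRegularAlgebraic ∧ P.1.IsGalConjEssSelfDual c₀ χ ∧ ∀ 𝔭 ∉ S, P.1.IsUnramifiedAt 𝔭 ∧ Literature.NumberTheory.Automorphic.IsGaloisCompatibleAt P.1 ι r 𝔭 ∧ ∃ (α : Multiset ℂ) (t : (integralClosure ℤ ℂ)), P.1.HasSatakeParamAt 𝔭 α ∧ (t : ℂ) = (𝔭.residueCard : ℂ) * α.sum - e (Literature.NumberTheory.GaloisRepresentations.picardTrace f 𝔭) ∧ ‖ι.symm (t : ℂ)‖ ≤ ((3 : ℝ)⁻¹) ^ k) → ∃ (e : (CyclotomicField 3 ℚ) →+* ℂ) (π : Literature.NumberTheory.Automorphic.CuspidalAutomorphicRepData 3 (CyclotomicField 3 ℚ) hcpt), π.1.IsLAlgebraic ∧ ∀ᶠ 𝔭 : IsDedekindDomain.HeightOneSpectrum (NumberField.RingOfIntegers (CyclotomicField 3 ℚ)) in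 Filter.cofinite, ∃ α : Multiset ℂ, π.1.HasSatakeParamAt 𝔭 α ∧ α.sum = e (Literature.NumberTheory.GaloisRepresentations.picardTrace f 𝔭) := by
  intro f hcpt hdeg hsep hgal hyp
  classical
  obtain ⟨e, ι, S, c₀, hc₀, hS3, htower⟩ := hyp
  -- the avatar limit
  obtain ⟨ρ, -, hρ⟩ := exists_avatarLimit_ess f hcpt ι e S c₀ htower
  -- R: residual absolute irreducibility, hence absolute irreducibility (Darmon–Diamond–Taylor §2.1)
  have hres : ρ.IsResiduallyAbsIrreducible :=
    isResiduallyAbsIrreducible_of_frobTraces_untwisted f hdeg hsep hgal ι e S ρ fun 𝔭 h𝔭 => (hρ 𝔭 h𝔭).2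
  have habs : FramedRep.IsAbsolutelyIrreducible ρ :=
    FramedGaloisRep.IsResiduallyAbsIrreducible.isAbsolutelyIrreducible (by norm_num) hres
  -- G♮: the geometric de Rham representation with the same traces off `S₁ ⊇ S`
  obtain ⟨ρ', S₁, hSS₁, hgeo, habs', hdR'⟩ := geometricDeRhamInput_untwisted hF1 f hdeg hsep hgal ι e S
  -- I: de Rham-ness transfers to `ρ`
  have hdR : ∀ (v : HeightOneSpectrum (𝓞 (CyclotomicField 3 ℚ))) (hv : ((3 : ℕ) : 𝓞 (CyclotomicField 3 ℚ)) ∈ v.asIdeal),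
      (PAdicHodge.fontainePstAdicCompletion v 3 hv).IsDeRhamFramed (ρ.toLocal v) := by
    refine stub_traceIdentification S₁ ρ ρ' habs habs' (fun 𝔭 h𝔭 𝔓 h𝔓 τ hτ => ?_) hdR'
    rw [(hρ 𝔭 (fun h => h𝔭 (hSS₁ h))).2 𝔓 h𝔓 τ hτ, (hgeo 𝔭 h𝔭).2 𝔓 h𝔓 τ hτ]
  -- H♮, with the tower clause rewritten through the limit traces
  obtain ⟨π', S', hLalg, hcompat⟩ := hH hcpt ι c₀ S ρ hc₀ hS3 hres hdR (fun 𝔭 h𝔭 => (hρ 𝔭 h𝔭).1) (fun k => by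
    obtain ⟨P, r, χ, hreg, hess, hP⟩ := htower k
    refine ⟨P, r, χ, hreg, hess, fun 𝔭 h𝔭 => ?_⟩
    obtain ⟨hunr, hcomp, α, t, hsat, ht, hbound⟩ := hP 𝔭 h𝔭
    refine ⟨hunr, hcomp, α, hsat, fun 𝔓 h𝔓 τ hτ => ?_⟩
    rw [(hρ 𝔭 h𝔭).2 𝔓 h𝔓 τ hτ, ← map_sub, ← ht]
    exact hbound)
  -- the conclusion: `Σα = e(a_𝔭)` off `S' ∪ S`
  refine ⟨e, π', hLalg, ?_⟩
  filter_upwards [(S' ∪ S).eventually_cofinite_notMem] with 𝔭 h𝔭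
  rw [Finset.mem_union, not_or] at h𝔭
  obtain ⟨α, hsat, -, hchar⟩ := hcompat 𝔭 h𝔭.1
  obtain ⟨𝔓, h𝔓⟩ := 𝔭.primesAbove_nonempty
  obtain ⟨τ, hτ⟩ := HeightOneSpectrum.exists_isArithFrobAt_of_mem_primesAbove_holds h𝔓
  have h1 := Summit.Langlands.Langlands.Theorems.IrregularClassicality.SplitRamifiedPrimeSqrt6.trace_inv_eq_of_hasFrobCharpolyAt_one ι ρ hchar h𝔓 hτ
  rw [(hρ 𝔭 h𝔭.2).2 𝔓 h𝔓 τ hτ] at h1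
  exact ⟨α, hsat, (ι.symm.injective h1).symm⟩

/-- **The typed crux from W♮, F1 and H♮** (skeleton r14 of the line `slope-free-polarized-limit`, its three `sorry`s as
hypotheses): W♮ takes the crux hypothesis VERBATIM (untwisted `𝔐`-currency tower) to an essentially-polarized avatar
tower for the untwisted traces; then `irregularClassicalityEssPolarized_of_essHeart`.  No CM twist, no Weil character,
no `LimitTwist`, no F2/F3. -/
theorem irregularClassicality_of_essWall_of_essHeart : (∀ (f : Polynomial ℤ) (hcpt : Literature.NumberTheory.Automorphic.isCompact_glFiniteIntegralLevel 3 (CyclotomicField 3 ℚ)), f.natDegree = 4 → (f.map (Int.castRingHom ℚ)).Separable → 12 ∣ Nat.card (f.map (Int.castRingHom ℚ)).Gal → (∃ (e : CyclotomicField 3 ℚ →+* ℂ) (𝔐 : Ideal (integralClosure ℤ ℂ)) (S : Finset (IsDedekindDomain.HeightOneSpectrum (NumberField.RingOfIntegers (CyclotomicField 3 ℚ)))), 𝔐.IsMaximal ∧ (3 : (integralClosure ℤ ℂ)) ∈ 𝔐 ∧ ∀ k : ℕ, ∃ P : Literature.NumberTheory.Automorphic.CuspidalAutomorphicRepData 3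 (CyclotomicField 3 ℚ) hcpt, P.1.IsRegularAlgebraic ∧ ∀ 𝔭 ∉ S, ∃ (α : Multiset ℂ) (t u : (integralClosure ℤ ℂ)), P.1.HasSatakeParamAt 𝔭 α ∧ (t : ℂ) = (𝔭.residueCard : ℂ) * α.sum - e (Literature.NumberTheory.GaloisRepresentations.picardTrace f 𝔭) ∧ u ∉ 𝔐 ∧ u * t ∈ Ideal.span {(3 : (integralClosure ℤ ℂ)) ^ k}) → ∃ (e : (CyclotomicField 3 ℚ) →+* ℂ) (ι : PadicAlgCl 3 ≃+* ℂ) (S : Finset (IsDedekindDomain.HeightOneSpectrum (NumberField.RingOfIntegers (CyclotomicField 3 ℚ)))) (c₀ : (CyclotomicField 3 ℚ) ≃ₐ[ℚ] (CyclotomicField 3 ℚ)), c₀ ≠ 1 ∧ (∀ v : IsDedekindDomain.HeightOneSpectrum (NumberField.RingOfIntegers (CyclotomicField 3 ℚ)), ((3 : ℕ) : NumberField.RingOfIntegers (CyclotomicField 3 ℚ)) ∈ v.asIdeal → v ∈ S) ∧ ∀ k : ℕ, ∃ (P : Literature.NumberTheory.Automorphic.CuspidalAutomorphicRepData 3 (CyclotomicField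 3 ℚ) hcpt) (r : Literature.NumberTheory.GaloisRepresentations.FramedGaloisRep (CyclotomicField 3 ℚ) (PadicAlgCl 3) 3) (χ : Literature.NumberTheory.GaloisRepresentations.HeckeCharacter (CyclotomicField 3 ℚ)), P.1.IsRegularAlgebraic ∧ P.1.IsGalConjEssSelfDual c₀ χ ∧ ∀ 𝔭 ∉ S, P.1.IsUnramifiedAt 𝔭 ∧ Literature.NumberTheory.Automorphic.IsGaloisCompatibleAt P.1 ι r 𝔭 ∧ ∃ (α : Multiset ℂ) (t : (integralClosure ℤ ℂ)), P.1.HasSatakeParamAt 𝔭 α ∧ (t : ℂ) = (𝔭.residueCard : ℂ) * α.sum - e (Literature.NumberTheory.GaloisRepresentations.picardTrace f 𝔭) ∧ ‖ι.symm (t : ℂ)‖ ≤ ((3 : ℝ)⁻¹) ^ k) → Literature.NumberTheory.GaloisRepresentations.picardCurve_exists_lambdaAdicRep_isDeRhamFramed → (∀ (hcpt : isCompact_glFiniteIntegralLevel 3 (CyclotomicField 3 ℚ)) (ι : PadicAlgCl 3 ≃+* ℂ) (c₀ : (CyclotomicField 3 ℚ) ≃ₐ[ℚ] (CyclotomicField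 3 ℚ)) (S : Finset (HeightOneSpectrum (𝓞 (CyclotomicField 3 ℚ)))) (ρ : FramedGaloisRep (CyclotomicField 3 ℚ) (PadicAlgCl 3) 3), c₀ ≠ 1 → (∀ v : HeightOneSpectrum (𝓞 (CyclotomicField 3 ℚ)), ((3 : ℕ) : 𝓞 (CyclotomicField 3 ℚ)) ∈ v.asIdeal → v ∈ S) → ρ.IsResiduallyAbsIrreducible → (∀ (v : HeightOneSpectrum (𝓞 (CyclotomicField 3 ℚ))) (hv : ((3 : ℕ) : 𝓞 (CyclotomicField 3 ℚ)) ∈ v.asIdeal), (PAdicHodge.fontainePstAdicCompletion v 3 hv).IsDeRhamFramed (ρ.toLocal v)) → (∀ 𝔭 ∉ S, ρ.IsUnramifiedAt 𝔭) → (∀ k : ℕ, ∃ (P : CuspidalAutomorphicRepData 3 (CyclotomicField 3 ℚ) hcpt) (r : FramedGaloisRep (CyclotomicField 3 ℚ) (PadicAlgCl 3) 3) (χ : Literature.NumberTheory.GaloisRepresentations.HeckeCharacter (CyclotomicField 3 ℚ)), P.1.IsRegularAlgebraic ∧ P.1.IsGalConjEssSelfDual c₀ χ ∧ ∀ 𝔭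 ∉ S, P.1.IsUnramifiedAt 𝔭 ∧ IsGaloisCompatibleAt P.1 ι r 𝔭 ∧ ∃ α : Multiset ℂ, P.1.HasSatakeParamAt 𝔭 α ∧ ∀ 𝔓 ∈ 𝔭.primesAbove, ∀ τ : absoluteGaloisGroup (CyclotomicField 3 ℚ), IsArithFrobAt (𝓞 (CyclotomicField 3 ℚ)) τ 𝔓 → ‖ι.symm ((𝔭.residueCard : ℂ) * α.sum) - FramedRep.trace ρ τ⁻¹‖ ≤ ((3 : ℝ)⁻¹) ^ k) → ∃ (π' : CuspidalAutomorphicRepData 3 (CyclotomicField 3 ℚ) hcpt) (S' : Finset (HeightOneSpectrum (𝓞 (CyclotomicField 3 ℚ)))), π'.1.IsLAlgebraic ∧ ∀ 𝔭 ∉ S', ∃ α : Multiset ℂ, π'.1.HasSatakeParamAt 𝔭 α ∧ ρ.IsUnramifiedAt 𝔭 ∧ ρ.HasFrobCharpolyAt 𝔭 (arithFrobPolyOfSatake ι 𝔭.residueCard 1 α)) → Summit.Langlands.Langlands.Theses.PicardMuOrdinary.IrregularClassicality :=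
  fun hW hF1 hH f hcpt hdeg hsep hgal hyp =>
    irregularClassicalityEssPolarized_of_essHeart hF1 hH f hcpt hdeg hsep hgal (hW f hcpt hdeg hsep hgal hyp)

end

end Summit.Langlands.Langlands.Theorems.IrregularClassicality.SlopeFreePolarizedLimit


/-! ### Appended 2026-08-17 (lead c16, same cycle): the split glue `W♮ → C3♮ → crux` -/

namespace Summit.Langlands.Langlands.Theorems.IrregularClassicality.SlopeFreePolarizedLimit

/-- **The typed crux from W♮ and C3♮** — the `--glue-by` theorem for a split of the crux into the children
`EssPolarizationDebt` (= W♮, the registered `stub_essPolarizationDebt` VERBATIM) and `IrregularClassicalityEssPolarized`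
(= C3♮, VERBATIM the conclusion of `irregularClassicalityEssPolarized_of_essHeart`), untwisted essentially-polarized
currency; the analogue of `irregularClassicality_of_polarized` (p141145) with no `LimitTwist` inside: W♮ takes the crux
hypothesis verbatim to C3♮'s hypothesis. -/
theorem irregularClassicality_of_essPolarized : (∀ (f : Polynomial ℤ) (hcpt : Literature.NumberTheory.Automorphic.isCompact_glFiniteIntegralLevel 3 (CyclotomicField 3 ℚ)), f.natDegree = 4 → (f.map (Int.castRingHom ℚ)).Separable → 12 ∣ Nat.card (f.map (Int.castRingHom ℚ)).Gal → (∃ (e : CyclotomicField 3 ℚ →+* ℂ) (𝔐 : Ideal (integralClosure ℤ ℂ)) (S : Finset (IsDedekindDomain.HeightOneSpectrum (NumberField.RingOfIntegers (CyclotomicField 3 ℚ)))), 𝔐.IsMaximal ∧ (3 : (integralClosure ℤ ℂ)) ∈ 𝔐 ∧ ∀ k : ℕ, ∃ P : Literature.NumberTheory.Automorphic.CuspidalAutomorphicRepData 3 (CyclotomicField 3 ℚ) hcpt, P.1.IsRegularAlgebraic ∧ ∀ 𝔭 ∉ S, ∃ (α : Multiset ℂ) (t u : (integralClosure ℤ ℂ)),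 P.1.HasSatakeParamAt 𝔭 α ∧ (t : ℂ) = (𝔭.residueCard : ℂ) * α.sum - e (Literature.NumberTheory.GaloisRepresentations.picardTrace f 𝔭) ∧ u ∉ 𝔐 ∧ u * t ∈ Ideal.span {(3 : (integralClosure ℤ ℂ)) ^ k}) → ∃ (e : (CyclotomicField 3 ℚ) →+* ℂ) (ι : PadicAlgCl 3 ≃+* ℂ) (S : Finset (IsDedekindDomain.HeightOneSpectrum (NumberField.RingOfIntegers (CyclotomicField 3 ℚ)))) (c₀ : (CyclotomicField 3 ℚ) ≃ₐ[ℚ] (CyclotomicField 3 ℚ)), c₀ ≠ 1 ∧ (∀ v : IsDedekindDomain.HeightOneSpectrum (NumberField.RingOfIntegers (CyclotomicField 3 ℚ)), ((3 : ℕ) : NumberField.RingOfIntegers (CyclotomicField 3 ℚ)) ∈ v.asIdeal → v ∈ S) ∧ ∀ k : ℕ, ∃ (P : Literature.NumberTheory.Automorphic.CuspidalAutomorphicRepData 3 (CyclotomicField 3 ℚ) hcpt) (r : Literature.NumberTheory.GaloisRepresentations.FramedGaloisRep (CyclotomicField 3 ℚ) (PadicAlgCl 3) 3) (χ : Literature.NumberTheory.GaloisRepresentations.HeckeCharacter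 (CyclotomicField 3 ℚ)), P.1.IsRegularAlgebraic ∧ P.1.IsGalConjEssSelfDual c₀ χ ∧ ∀ 𝔭 ∉ S, P.1.IsUnramifiedAt 𝔭 ∧ Literature.NumberTheory.Automorphic.IsGaloisCompatibleAt P.1 ι r 𝔭 ∧ ∃ (α : Multiset ℂ) (t : (integralClosure ℤ ℂ)), P.1.HasSatakeParamAt 𝔭 α ∧ (t : ℂ) = (𝔭.residueCard : ℂ) * α.sum - e (Literature.NumberTheory.GaloisRepresentations.picardTrace f 𝔭) ∧ ‖ι.symm (t : ℂ)‖ ≤ ((3 : ℝ)⁻¹) ^ k) → (∀ (f : Polynomial ℤ) (hcpt : Literature.NumberTheory.Automorphic.isCompact_glFiniteIntegralLevel 3 (CyclotomicField 3 ℚ)), f.natDegree = 4 → (f.map (Int.castRingHom ℚ)).Separable → 12 ∣ Nat.card (f.map (Int.castRingHom ℚ)).Gal → (∃ (e : (CyclotomicField 3 ℚ) →+* ℂ) (ι : PadicAlgCl 3 ≃+* ℂ) (S : Finset (IsDedekindDomain.HeightOneSpectrum (NumberField.RingOfIntegers (CyclotomicField 3 ℚ)))) (c₀ : (CyclotomicField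 3 ℚ) ≃ₐ[ℚ] (CyclotomicField 3 ℚ)), c₀ ≠ 1 ∧ (∀ v : IsDedekindDomain.HeightOneSpectrum (NumberField.RingOfIntegers (CyclotomicField 3 ℚ)), ((3 : ℕ) : NumberField.RingOfIntegers (CyclotomicField 3 ℚ)) ∈ v.asIdeal → v ∈ S) ∧ ∀ k : ℕ, ∃ (P : Literature.NumberTheory.Automorphic.CuspidalAutomorphicRepData 3 (CyclotomicField 3 ℚ) hcpt) (r : Literature.NumberTheory.GaloisRepresentations.FramedGaloisRep (CyclotomicField 3 ℚ) (PadicAlgCl 3) 3) (χ : Literature.NumberTheory.GaloisRepresentations.HeckeCharacter (CyclotomicField 3 ℚ)), P.1.IsRegularAlgebraic ∧ P.1.IsGalConjEssSelfDual c₀ χ ∧ ∀ 𝔭 ∉ S, P.1.IsUnramifiedAt 𝔭 ∧ Literature.NumberTheory.Automorphic.IsGaloisCompatibleAt P.1 ι r 𝔭 ∧ ∃ (α : Multiset ℂ) (t : (integralClosure ℤ ℂ)), P.1.HasSatakeParamAt 𝔭 α ∧ (t : ℂ) = (𝔭.residueCard : ℂ) * α.sum - e (Literature.NumberTheory.GaloisRepresentations.picardTrace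 f 𝔭) ∧ ‖ι.symm (t : ℂ)‖ ≤ ((3 : ℝ)⁻¹) ^ k) → ∃ (e : (CyclotomicField 3 ℚ) →+* ℂ) (π : Literature.NumberTheory.Automorphic.CuspidalAutomorphicRepData 3 (CyclotomicField 3 ℚ) hcpt), π.1.IsLAlgebraic ∧ ∀ᶠ 𝔭 : IsDedekindDomain.HeightOneSpectrum (NumberField.RingOfIntegers (CyclotomicField 3 ℚ)) in Filter.cofinite, ∃ α : Multiset ℂ, π.1.HasSatakeParamAt 𝔭 α ∧ α.sum = e (Literature.NumberTheory.GaloisRepresentations.picardTrace f 𝔭)) → Summit.Langlands.Langlands.Theses.PicardMuOrdinary.IrregularClassicality :=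
  fun hW hC3 f hcpt hdeg hsep hgal hyp => hC3 f hcpt hdeg hsep hgal (hW f hcpt hdeg hsep hgal hyp)

/-- **C3♮ is a weakening of the target** `PicardAutomorphy` (no refutation room short of a non-automorphic generic Picard
curve): its conclusion IS the target's. -/
theorem irregularClassicalityEssPolarized_of_picardAutomorphy
    (hX : Summit.Langlands.Langlands.Theses.PicardMuOrdinary.PicardAutomorphy) :
    ∀ (f : Polynomial ℤ) (hcpt : Literature.NumberTheory.Automorphic.isCompact_glFiniteIntegralLevel 3 (CyclotomicField 3 ℚ)), f.natDegree = 4 → (f.map (Int.castRingHom ℚ)).Separable → 12 ∣ Nat.card (f.map (Int.castRingHom ℚ)).Gal → (∃ (e : (CyclotomicField 3 ℚ) →+* ℂ) (ι : PadicAlgCl 3 ≃+* ℂ) (S : Finset (IsDedekindDomain.HeightOneSpectrum (NumberField.RingOfIntegers (CyclotomicField 3 ℚ)))) (c₀ : (CyclotomicField 3 ℚ) ≃ₐ[ℚ] (CyclotomicField 3 ℚ)), c₀ ≠ 1 ∧ (∀ v : IsDedekindDomain.HeightOneSpectrum (NumberField.RingOfIntegers (CyclotomicField 3 ℚ)), ((3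 : ℕ) : NumberField.RingOfIntegers (CyclotomicField 3 ℚ)) ∈ v.asIdeal → v ∈ S) ∧ ∀ k : ℕ, ∃ (P : Literature.NumberTheory.Automorphic.CuspidalAutomorphicRepData 3 (CyclotomicField 3 ℚ) hcpt) (r : Literature.NumberTheory.GaloisRepresentations.FramedGaloisRep (CyclotomicField 3 ℚ) (PadicAlgCl 3) 3) (χ : Literature.NumberTheory.GaloisRepresentations.HeckeCharacter (CyclotomicField 3 ℚ)), P.1.IsRegularAlgebraic ∧ P.1.IsGalConjEssSelfDual c₀ χ ∧ ∀ 𝔭 ∉ S, P.1.IsUnramifiedAt 𝔭 ∧ Literature.NumberTheory.Automorphic.IsGaloisCompatibleAt P.1 ι r 𝔭 ∧ ∃ (α : Multiset ℂ) (t : (integralClosure ℤ ℂ)), P.1.HasSatakeParamAt 𝔭 α ∧ (t : ℂ) = (𝔭.residueCard : ℂ) * α.sum - e (Literature.NumberTheory.GaloisRepresentations.picardTrace f 𝔭) ∧ ‖ι.symm (t : ℂ)‖ ≤ ((3 : ℝ)⁻¹) ^ k) → ∃ (e : (CyclotomicField 3 ℚ) →+* ℂ) (π : Literature.NumberTheory.Automorphic.CuspidalAutomorphicRepData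 3 (CyclotomicField 3 ℚ) hcpt), π.1.IsLAlgebraic ∧ ∀ᶠ 𝔭 : IsDedekindDomain.HeightOneSpectrum (NumberField.RingOfIntegers (CyclotomicField 3 ℚ)) in Filter.cofinite, ∃ α : Multiset ℂ, π.1.HasSatakeParamAt 𝔭 α ∧ α.sum = e (Literature.NumberTheory.GaloisRepresentations.picardTrace f 𝔭) :=
  fun f hcpt hdeg hsep hgal _ => hX f hcpt hdeg hsep hgal

end Summit.Langlands.Langlands.Theorems.IrregularClassicality.SlopeFreePolarizedLimit
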